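import Summits.Ventures.Crystal3D.Theorems.StickyWulffConstantPolycrystalWulffBoundTwinCapsChimera
import Summits.Ventures.Crystal3D.Theorems.StickyWulffConstantPolycrystalWulffBoundBasalLamellarChimera
import Summits.Ventures.Crystal3D.Theorems.StickyWulffConstantPolycrystalWulffBoundCapHeight

/-!
# `PolycrystalWulffBound`, rung `rung_twinColonies` — the CHIMERA lower bound for a grain carrying
# finitely many separated LAMELLAR TWIN COLONIES about different axes, LOCALIZED parent clause
# (line `PolyDensity`, crux `stmt-Ventures-19482`)

Route `StickyWulffConstant` of the venture `Summits/Ventures/Crystal3D`, second prover lane (poly-p2,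
gen 12).  Generalizes `twinCaps_chimera_lower` (one cap per axis, parent globally below every cap plane)
in two directions at once, with the same engine `piecewise_chimera_lower`:
* COLONIES: above the base plane `⟪x, m i⟫ = t i 0` of facet `i` sits a STACK of `n` lamellae
  `L i j ⊆ {t i j < ⟪x, m i⟫ < t i (j+1)}` with frames `B i j`, every one co-axial with the parent frame
  `A₀` about `m i` (parent lattice / its twin, alternating or not) — the planner's (P-R2) «thick colonies
  of different axes joined to a common parent through free basal walls»;
* LOCALIZATION: the parent need not lie below the base planes globally — only its points within
  distance `δ` of colony `i` must (`⟪x, m i⟫ < t i 0 ∨ δ ≤ dist(x, colony i)`): twin plates on PART of a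
  large face, caps on a non-convex container.
Targets: colony `i`, lamella `j` ↦ the slab `W(B i j) ∩ {s i j < ⟪y, m i⟫ ≤ s i (j+1)}` between
consecutive QUANTILE heights of the cumulative colony fractions (`|W(A₀) ∩ {s i jj < ⟪y,m i⟫}| = 32·U i jj`,
`U i jj` = volume fraction of the lamellae `j ≥ jj` of colony `i`); parent ↦ `W(A₀) ∩ {∀ i, ⟪y,m i⟫ ≤ s i 0}`.
Regions: sorted height windows `t i jj + r·s i jj` per axis ∩ `r(√5+1)`-thickenings of the lamellae;
the parent's region is «below `t i 0 + r s i 0` wherever near colony `i`».  Conclusion: `|E'|^{1/3} +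
r·32^{1/3} ≤ |U|^{1/3}` for `U ⊇` chimera neighbourhood, `0 < r`, `2(√5+1)·r ≤ δ` and `≤` every gap.
WHAT THIS IS NOT: the rung (`…RungTwinColonies.lean`); colonies touching each other, or secondary twins
about a second axis inside a colony, are not covered; the crux is not claimed.
-/

noncomputable section

open scoped BigOperators InnerProductSpace ENNReal Pointwise
open MeasureTheory Set

namespace Summit.Ventures.Crystal3D.Theorems

open Summit.Ventures.Crystal3D.Cruxes.TextureLiminf.TexShadow (E3)
open Literature.MathematicalPhysics.StatisticalMechanics (fccStacking barlowStacking IsHaggSeq)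

/-- **Chimera lower bound for a grain with separated lamellar twin colonies about different axes
(localized parent clause).**  See the module docstring for the data; the frames enter only through the
self-clauses of `A₀` and of every `B i j` about the axis `m i` (both follow from the crux's
`Ax (m i) A₀ (B i j)`). -/
theorem twinColonies_chimera_lower {k n : ℕ} (m : Fin k → E3) (t : Fin k → Fin (n + 1) → ℝ)
    (ht : ∀ i, StrictMono (t i))
    (A₀ : E3 ≃ₗᵢ[ℝ] E3) (B : Fin k → Fin n → (E3 ≃ₗᵢ[ℝ] E3))
    (hA₀ : ∀ i, ∃ (L : E3 ≃ₗᵢ[ℝ] E3) (s₁ s₂ : E3) (σ σ' : ℤ → ℤ), IsHaggSeq σ ∧ IsHaggSeq σ' ∧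
      L (EuclideanSpace.single (2 : Fin 3) (1 : ℝ)) = m i ∧
      A₀ '' fccStacking 1 (Real.sqrt (2 / 3)) ⊆
        (fun q => L q + s₁) '' barlowStacking 1 (Real.sqrt (2 / 3)) σ ∧
      A₀ '' fccStacking 1 (Real.sqrt (2 / 3)) ⊆
        (fun q => L q + s₂) '' barlowStacking 1 (Real.sqrt (2 / 3)) σ')
    (hB : ∀ i j, ∃ (L : E3 ≃ₗᵢ[ℝ] E3) (s₁ s₂ : E3) (σ σ' : ℤ → ℤ), IsHaggSeq σ ∧ IsHaggSeq σ' ∧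
      L (EuclideanSpace.single (2 : Fin 3) (1 : ℝ)) = m i ∧
      B i j '' fccStacking 1 (Real.sqrt (2 / 3)) ⊆
        (fun q => L q + s₁) '' barlowStacking 1 (Real.sqrt (2 / 3)) σ ∧
      B i j '' fccStacking 1 (Real.sqrt (2 / 3)) ⊆
        (fun q => L q + s₂) '' barlowStacking 1 (Real.sqrt (2 / 3)) σ')
    (P : Set E3) (L : Fin k → Fin n → Set E3) (hPo : IsOpen P) (hLo : ∀ i j, IsOpen (L i j))
    (hLt : ∀ i j, ∀ x ∈ L i j, t i j.castSucc < ⟪x, m i⟫_ℝ ∧ ⟪x, m i⟫_ℝ < t i j.succ)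
    {δ : ℝ} (hδ : 0 < δ)
    (hPt : ∀ x ∈ P, ∀ i, ⟪x, m i⟫_ℝ < t i 0 ∨ ∀ j, ∀ y ∈ L i j, δ ≤ dist x y)
    (hsep : ∀ i i', i ≠ i' → ∀ j j', ∀ x ∈ L i j, ∀ y ∈ L i' j', δ ≤ dist x y)
    (h0 : volume (P ∪ ⋃ i, ⋃ j, L i j) ≠ 0) (htop : volume (P ∪ ⋃ i, ⋃ j, L i j) ≠ ⊤)
    {r : ℝ} (hr : 0 < r) (hrδ : r * (2 * (Real.sqrt 5 + 1)) ≤ δ)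
    (hrt : ∀ i (j : Fin n), r * (2 * (Real.sqrt 5 + 1)) ≤ t i j.succ - t i j.castSucc)
    {U : Set E3}
    (hsubP : ∀ x ∈ P, ∀ w ∈ {y : E3 | ∀ ν : E3, ⟪y, ν⟫_ℝ ≤ Real.sqrt 2 / 4 *
        ∑ᶠ w ∈ {w | w ∈ fccStacking 1 (Real.sqrt (2 / 3)) ∧ ‖w‖ = 1}, |⟪w, A₀.symm ν⟫_ℝ|},
      x + r • w ∈ U)
    (hsubL : ∀ i j, ∀ x ∈ L i j, ∀ w ∈ {y : E3 | ∀ ν : E3, ⟪y, ν⟫_ℝ ≤ Real.sqrt 2 / 4 *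
        ∑ᶠ w ∈ {w | w ∈ fccStacking 1 (Real.sqrt (2 / 3)) ∧ ‖w‖ = 1}, |⟪w, (B i j).symm ν⟫_ℝ|},
      x + r • w ∈ U) :
    volume (P ∪ ⋃ i, ⋃ j, L i j) ^ ((3 : ℕ)⁻¹ : ℝ) +
        ENNReal.ofReal r * (ENNReal.ofReal 32) ^ ((3 : ℕ)⁻¹ : ℝ) ≤ volume U ^ ((3 : ℕ)⁻¹ : ℝ) := by
  classical
  -- the bodies
  set body : (E3 ≃ₗᵢ[ℝ] E3) → Set E3 := fun X => {y : E3 | ∀ ν : E3, ⟪y, ν⟫_ℝ ≤ Real.sqrt 2 / 4 *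
    ∑ᶠ w ∈ {w | w ∈ fccStacking 1 (Real.sqrt (2 / 3)) ∧ ‖w‖ = 1}, |⟪w, X.symm ν⟫_ℝ|} with hbody
  have hWc : ∀ X, IsCompact (body X) := fun X => isCompact_cruxWulffBody X
  have hWm : ∀ X, MeasurableSet (body X) := fun X => (hWc X).isClosed.measurableSet
  have hWball : ∀ X, body X ⊆ Metric.closedBall (0 : E3) (Real.sqrt 5) :=
    fun X => cruxWulffBody_subset_closedBall X
  have hWvol : ∀ X, volume (body X) = ENNReal.ofReal 32 := fun X => volume_cruxWulffBody X
  have hm1 : ∀ i, ‖m i‖ = 1 := by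
    intro i
    obtain ⟨L', -, -, -, -, -, -, hLm, -, -⟩ := hA₀ i
    rw [← hLm, LinearIsometryEquiv.norm_map]
    simp
  have h51 : 0 < 2 * (Real.sqrt 5 + 1) := by positivity
  -- disjointness and measurability of the grains
  have ht0 : ∀ i (jj : Fin (n + 1)), t i 0 ≤ t i jj := fun i jj => (ht i).monotone (Fin.zero_le _)
  have hPL : ∀ i j, Disjoint P (L i j) := by
    intro i j
    rw [Set.disjoint_left]
    intro x hxP hxL
    rcases hPt x hxP i with h | h
    · exact lt_irrefl _ (lt_of_lt_of_le (h.trans_le (ht0 i _)) (hLt i j x hxL).1.le)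
    · have h' := h j x hxL
      rw [dist_self] at h'
      exact absurd h' (not_le.2 hδ)
  have hLL : ∀ i j j', j ≠ j' → Disjoint (L i j) (L i j') := fun i j j' hjj' =>
    Set.disjoint_left.2 fun x hx hx' => hjj' (lamella_index_unique (ht i) (hLt i j x hx) (hLt i j' x hx'))
  have hLL' : ∀ i i', i ≠ i' → ∀ j j', Disjoint (L i j) (L i' j') := fun i i' hii' j j' =>
    Set.disjoint_left.2 fun x hx hx' => by
      have h := hsep i i' hii' j j' x hx x hx'
      rw [dist_self] at h
      exact absurd h (not_le.2 hδ)
  -- the grains as one family on `Option (Fin k × Fin n)`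
  set G : Option (Fin k × Fin n) → Set E3 := fun o => o.elim P fun p => L p.1 p.2 with hG
  have hUG : (⋃ o, G o) = P ∪ ⋃ i, ⋃ j, L i j := by
    rw [Set.iUnion_option]
    show P ∪ ⋃ p : Fin k × Fin n, L p.1 p.2 = P ∪ ⋃ i, ⋃ j, L i j
    congr 1
    ext x
    simp only [mem_iUnion]
    exact ⟨fun ⟨p, hp⟩ => ⟨p.1, p.2, hp⟩, fun ⟨i, j, h⟩ => ⟨(i, j), h⟩⟩
  have hGo : ∀ o, IsOpen (G o) := fun o => o.rec hPo fun p => hLo p.1 p.2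
  have hdisjG : Pairwise fun o o' => Disjoint (G o) (G o') := by
    intro o o' hoo'
    cases o with
    | none =>
      cases o' with
      | none => exact absurd rfl hoo'
      | some p => exact hPL p.1 p.2
    | some p =>
      cases o' with
      | none => exact (hPL p.1 p.2).symm
      | some p' =>
        show Disjoint (L p.1 p.2) (L p'.1 p'.2)
        by_cases hi : p.1 = p'.1
        · have hj : p.2 ≠ p'.2 := fun hj => hoo' (by rw [Prod.ext hi hj])
          have h := hLL p'.1 p.2 p'.2 hj
          rwa [hi]
        · exact hLL' p.1 p'.1 hi p.2 p'.2
  -- volumes and fractions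
  set V : ℝ≥0∞ := volume (⋃ o, G o) with hV
  have h0' : V ≠ 0 := by rwa [hV, hUG]
  have htop' : V ≠ ⊤ := by rwa [hV, hUG]
  have hGm : ∀ o, MeasurableSet (G o) := fun o => (hGo o).measurableSet
  have hVsum : V = ∑ o, volume (G o) := by
    rw [hV, measure_iUnion (fun o o' h => hdisjG h) hGm, tsum_fintype]
  have hGfin : ∀ o, volume (G o) ≠ ⊤ := fun o =>
    (lt_of_le_of_lt (measure_mono (subset_iUnion G o)) htop'.lt_top).ne
  set Vr : ℝ := V.toReal with hVr
  set v : Option (Fin k × Fin n) → ℝ := fun o => (volume (G o)).toReal with hv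
  have hv0 : ∀ o, 0 ≤ v o := fun o => ENNReal.toReal_nonneg
  have hVr_eq : Vr = ∑ o, v o := by rw [hVr, hVsum, ENNReal.toReal_sum fun o _ => hGfin o]
  have hVr0 : 0 < Vr := ENNReal.toReal_pos h0' htop'
  set σ : Option (Fin k × Fin n) → ℝ := fun o => v o / Vr with hσ
  have hσ0 : ∀ o, 0 ≤ σ o := fun o => div_nonneg (hv0 o) hVr0.le
  have hσsum : ∑ o, σ o = 1 := by
    simp only [hσ]
    rw [← Finset.sum_div, ← hVr_eq, div_self hVr0.ne']
  -- cumulative colony fractions `U i jj = Σ_{j ≥ jj} σ (i, j)`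
  set Ucum : Fin k → Fin (n + 1) → ℝ := fun i jj =>
    ∑ j : Fin n, if jj ≤ j.castSucc then σ (some (i, j)) else 0 with hUcum
  have hU0 : ∀ i jj, 0 ≤ Ucum i jj := fun i jj =>
    Finset.sum_nonneg fun j _ => by split_ifs <;> [exact hσ0 _; exact le_rfl]
  have hUtop : ∀ i, Ucum i (Fin.last n) = 0 := by
    intro i
    refine Finset.sum_eq_zero fun j _ => ?_
    rw [if_neg (not_le.2 (Fin.castSucc_lt_last j))]
  have hUstep : ∀ i (j : Fin n), Ucum i j.castSucc = σ (some (i, j)) + Ucum i j.succ := by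
    intro i j
    have hterm : ∀ j' : Fin n, (if j.castSucc ≤ j'.castSucc then σ (some (i, j')) else 0) =
        (if j' = j then σ (some (i, j')) else 0) + (if j.succ ≤ j'.castSucc then σ (some (i, j')) else 0) := by
      intro j'
      by_cases h1 : j' = j
      · subst h1
        rw [if_pos le_rfl, if_pos rfl, if_neg (not_le.2 (Fin.castSucc_lt_succ (i := j'))), add_zero]
      · rw [if_neg h1, zero_add]
        by_cases h2 : j.castSucc ≤ j'.castSucc
        · have hlt : j < j' := lt_of_le_of_ne (Fin.castSucc_le_castSucc_iff.1 h2) (Ne.symm h1)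
          rw [if_pos h2, if_pos (Fin.castSucc_lt_iff_succ_le.1 (Fin.castSucc_lt_castSucc_iff.2 hlt))]
        · have h3 : ¬ j.succ ≤ j'.castSucc := fun h =>
            h2 ((Fin.castSucc_lt_succ (i := j)).le.trans h)
          rw [if_neg h2, if_neg h3]
    show (∑ j' : Fin n, if j.castSucc ≤ j'.castSucc then σ (some (i, j')) else 0) =
      σ (some (i, j)) + ∑ j' : Fin n, if j.succ ≤ j'.castSucc then σ (some (i, j')) else 0
    rw [Finset.sum_congr rfl fun j' _ => hterm j', Finset.sum_add_distrib, Finset.sum_ite_eq']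
    simp only [Finset.mem_univ, if_true]
  -- the colony totals are at most `1 − σ(parent)`
  have hUsum : σ none + ∑ i, Ucum i 0 ≤ 1 := by
    have h1 : ∑ i, Ucum i 0 = ∑ i, ∑ j : Fin n, σ (some (i, j)) := by
      refine Finset.sum_congr rfl fun i _ => Finset.sum_congr rfl fun j _ => ?_
      rw [if_pos (Fin.zero_le _)]
    rw [h1, ← hσsum, Fintype.sum_option]
    gcongr
    rw [← Finset.univ_product_univ, Finset.sum_product]
  have hU1 : ∀ i jj, Ucum i jj ≤ 1 := by
    intro i jj
    have h1 : Ucum i jj ≤ Ucum i 0 := Finset.sum_le_sum fun j _ => by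
      by_cases h : jj ≤ j.castSucc
      · rw [if_pos h, if_pos (Fin.zero_le _)]
      · rw [if_neg h]; split_ifs <;> [exact hσ0 _; exact le_rfl]
    have h2 : Ucum i 0 ≤ ∑ i', Ucum i' 0 :=
      Finset.single_le_sum (fun i' _ => hU0 i' 0) (Finset.mem_univ i)
    linarith [hσ0 none]
  -- exact cap heights `s i jj`: `|W(A₀) ∩ {s i jj < ⟪y, m i⟫}| = 32·U i jj`
  have hs : ∀ i jj, ∃ s : ℝ, |s| ≤ Real.sqrt 5 + 1 ∧
      volume (body A₀ ∩ {y : E3 | s < ⟪y, m i⟫_ℝ}) = ENNReal.ofReal (32 * Ucum i jj) :=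
    fun i jj => exists_capHeight_eq A₀ (m i) (hm1 i) (hU0 i jj) (hU1 i jj)
  choose s hsR hsvol using hs
  have hsB : ∀ i j jj, volume (body (B i j) ∩ {y : E3 | s i jj < ⟪y, m i⟫_ℝ}) =
      ENNReal.ofReal (32 * Ucum i jj) := by
    intro i j jj
    have h := volume_cruxWulffBody_inter_eq_of_coaxial (hA₀ i) (hB i j) (s i jj)
    show volume (body (B i j) ∩ {y : E3 | s i jj < ⟪y, m i⟫_ℝ}) = ENNReal.ofReal (32 * Ucum i jj)
    simp only [hbody]
    rw [h]
    exact hsvol i jj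
  -- the targets
  set TP : Set E3 := body A₀ ∩ {y : E3 | ∀ i, ⟪y, m i⟫_ℝ ≤ s i 0} with hTP
  set TL : Fin k → Fin n → Set E3 := fun i j =>
    body (B i j) ∩ {y : E3 | s i j.castSucc < ⟪y, m i⟫_ℝ ∧ ⟪y, m i⟫_ℝ ≤ s i j.succ} with hTL
  have hgt_m : ∀ i (c : ℝ), MeasurableSet {y : E3 | c < ⟪y, m i⟫_ℝ} := fun i c =>
    measurableSet_lt measurable_const (measurable_id.inner measurable_const)
  have hle_m : ∀ i (c : ℝ), MeasurableSet {y : E3 | ⟪y, m i⟫_ℝ ≤ c} := fun i c =>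
    measurableSet_le (measurable_id.inner measurable_const) measurable_const
  have hTPm : MeasurableSet TP := by
    refine (hWm A₀).inter ?_
    have : {y : E3 | ∀ i, ⟪y, m i⟫_ℝ ≤ s i 0} = ⋂ i, {y : E3 | ⟪y, m i⟫_ℝ ≤ s i 0} := by
      ext y; simp only [mem_setOf_eq, mem_iInter]
    rw [this]
    exact MeasurableSet.iInter fun i => hle_m i _
  have hTLm : ∀ i j, MeasurableSet (TL i j) := fun i j =>
    (hWm (B i j)).inter ((hgt_m i _).inter (hle_m i _))
  have hTLvol : ∀ i j, ENNReal.ofReal (32 * σ (some (i, j))) ≤ volume (TL i j) := by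
    intro i j
    have hcov : body (B i j) ∩ {y : E3 | s i j.castSucc < ⟪y, m i⟫_ℝ} ⊆
        TL i j ∪ (body (B i j) ∩ {y : E3 | s i j.succ < ⟪y, m i⟫_ℝ}) := by
      rintro y ⟨hy, hys⟩
      by_cases h : ⟪y, m i⟫_ℝ ≤ s i j.succ
      · exact Or.inl ⟨hy, hys, h⟩
      · exact Or.inr ⟨hy, not_le.1 h⟩
    have h1 : ENNReal.ofReal (32 * Ucum i j.castSucc) ≤
        volume (TL i j) + ENNReal.ofReal (32 * Ucum i j.succ) := by
      rw [← hsB i j j.castSucc, ← hsB i j j.succ]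
      exact (measure_mono hcov).trans (measure_union_le _ _)
    rw [hUstep i j, mul_add, ENNReal.ofReal_add (mul_nonneg (by norm_num) (hσ0 _))
      (mul_nonneg (by norm_num) (hU0 _ _))] at h1
    exact (ENNReal.add_le_add_iff_right ENNReal.ofReal_ne_top).1 h1
  have hTPvol : ENNReal.ofReal (32 * σ none) ≤ volume TP := by
    have hcover : body A₀ ⊆ TP ∪ ⋃ i, (body A₀ ∩ {y : E3 | s i 0 < ⟪y, m i⟫_ℝ}) := by
      intro y hy
      by_cases h : ∀ i, ⟪y, m i⟫_ℝ ≤ s i 0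
      · exact Or.inl ⟨hy, h⟩
      · simp only [not_forall, not_le] at h
        obtain ⟨i, hi⟩ := h
        exact Or.inr (mem_iUnion.2 ⟨i, hy, hi⟩)
    have h1 : ENNReal.ofReal 32 ≤ volume TP + ∑ i, ENNReal.ofReal (32 * Ucum i 0) := by
      calc ENNReal.ofReal 32 = volume (body A₀) := (hWvol A₀).symm
        _ ≤ volume (TP ∪ ⋃ i, (body A₀ ∩ {y : E3 | s i 0 < ⟪y, m i⟫_ℝ})) := measure_mono hcover
        _ ≤ volume TP + volume (⋃ i, (body A₀ ∩ {y : E3 | s i 0 < ⟪y, m i⟫_ℝ})) :=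
            measure_union_le _ _
        _ ≤ volume TP + ∑ i, volume (body A₀ ∩ {y : E3 | s i 0 < ⟪y, m i⟫_ℝ}) := by
            gcongr; exact measure_iUnion_fintype_le _ _
        _ = volume TP + ∑ i, ENNReal.ofReal (32 * Ucum i 0) := by
            congr 1; exact Finset.sum_congr rfl fun i _ => hsvol i 0
    have hTPfin : volume TP ≠ ⊤ :=
      (lt_of_le_of_lt (measure_mono inter_subset_left) (hWc A₀).measure_lt_top).ne
    rw [← ENNReal.ofReal_toReal hTPfin]
    apply ENNReal.ofReal_le_ofReal
    have h2 := ENNReal.toReal_mono (ENNReal.add_ne_top.2 ⟨hTPfin, ENNReal.sum_ne_top.2 fun i _ =>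
      ENNReal.ofReal_ne_top⟩) h1
    rw [ENNReal.toReal_ofReal (by norm_num : (0:ℝ) ≤ 32), ENNReal.toReal_add hTPfin
      (ENNReal.sum_ne_top.2 fun i _ => ENNReal.ofReal_ne_top), ENNReal.toReal_sum
      (fun i _ => ENNReal.ofReal_ne_top)] at h2
    simp only [ENNReal.toReal_ofReal (mul_nonneg (by norm_num : (0:ℝ) ≤ 32) (hU0 _ _))] at h2
    rw [← Finset.mul_sum] at h2
    nlinarith [hUsum, h2]
  -- the regions: sorted height windows `a i jj = t i jj + r·s i jj` and thickenings
  set ρ : ℝ := r * (Real.sqrt 5 + 1) with hρ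
  have hρ0 : 0 < ρ := by positivity
  set a : Fin k → Fin (n + 1) → ℝ := fun i jj => t i jj + r * s i jj with ha
  have ha_mono : ∀ i, Monotone (a i) := by
    intro i
    refine Fin.monotone_iff_le_succ.2 fun j => ?_
    have h1 := hrt i j
    have h2 : |s i j.castSucc| ≤ Real.sqrt 5 + 1 := hsR i _
    have h3 : |s i j.succ| ≤ Real.sqrt 5 + 1 := hsR i _
    rw [abs_le] at h2 h3
    show t i j.castSucc + r * s i j.castSucc ≤ t i j.succ + r * s i j.succ
    nlinarith [h2.1, h2.2, h3.1, h3.2, hr]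
  set RP : Set E3 := {y : E3 | ∀ i j, y ∈ Metric.thickening ρ (L i j) → ⟪y, m i⟫_ℝ < a i 0} with hRP
  set RL : Fin k → Fin n → Set E3 := fun i j =>
    {y : E3 | a i j.castSucc < ⟪y, m i⟫_ℝ ∧ ⟪y, m i⟫_ℝ < a i j.succ} ∩ Metric.thickening ρ (L i j) with hRL
  have hRPL : ∀ i j, Disjoint (U ∩ RP) (U ∩ RL i j) := fun i j => Set.disjoint_left.2 fun y hy hy' => by
    have h1 : ⟪y, m i⟫_ℝ < a i 0 := hy.2 i j hy'.2.2
    have h2 : a i j.castSucc < ⟪y, m i⟫_ℝ := hy'.2.1.1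
    exact lt_irrefl _ ((h1.trans_le (ha_mono i (Fin.zero_le _))).trans h2)
  have hRLL : ∀ i j j', j ≠ j' → Disjoint (U ∩ RL i j) (U ∩ RL i j') := by
    intro i j j' hjj'
    rw [Set.disjoint_left]
    rintro y ⟨-, ⟨hy1, hy2⟩, -⟩ ⟨-, ⟨hy1', hy2'⟩, -⟩
    rcases lt_or_gt_of_ne hjj' with h | h
    · have h1 : a i j.succ ≤ a i j'.castSucc :=
        ha_mono i (Fin.castSucc_lt_iff_succ_le.1 (Fin.castSucc_lt_castSucc_iff.2 h))
      linarith
    · have h1 : a i j'.succ ≤ a i j.castSucc :=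
        ha_mono i (Fin.castSucc_lt_iff_succ_le.1 (Fin.castSucc_lt_castSucc_iff.2 h))
      linarith
  have hRLL' : ∀ i i', i ≠ i' → ∀ j j', Disjoint (U ∩ RL i j) (U ∩ RL i' j') := by
    intro i i' hii' j j'
    rw [Set.disjoint_left]
    rintro y ⟨-, -, hyi⟩ ⟨-, -, hyj⟩
    obtain ⟨x, hx, hdx⟩ := Metric.mem_thickening_iff.1 hyi
    obtain ⟨x', hx', hdx'⟩ := Metric.mem_thickening_iff.1 hyj
    have h1 : δ ≤ dist x x' := hsep i i' hii' j j' x hx x' hx'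
    have h2 : dist x x' < ρ + ρ := (dist_triangle x y x').trans_lt (by
      rw [dist_comm x y]; exact add_lt_add hdx hdx')
    linarith
  -- the swollen pieces lie in `U` and in their regions
  have hincP : P + r • TP ⊆ U ∩ RP := by
    rintro z ⟨x, hx, y, hy, rfl⟩
    obtain ⟨p, hp, rfl⟩ := Set.mem_smul_set.1 hy
    refine ⟨hsubP x hx p hp.1, fun i j hz => ?_⟩
    obtain ⟨y, hyL, hdy⟩ := Metric.mem_thickening_iff.1 hz
    have hp5 : ‖p‖ ≤ Real.sqrt 5 := mem_closedBall_zero_iff.1 (hWball A₀ hp.1)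
    have hdist : dist x y < δ :=
      calc dist x y ≤ dist x (x + r • p) + dist (x + r • p) y := dist_triangle _ _ _
        _ = r * ‖p‖ + dist (x + r • p) y := by
            rw [dist_eq_norm, sub_add_cancel_left, norm_neg, norm_smul, Real.norm_of_nonneg hr.le]
        _ < r * Real.sqrt 5 + ρ := add_lt_add_of_le_of_lt (by gcongr) hdy
        _ ≤ δ := by rw [hρ]; nlinarith
    have hxt : ⟪x, m i⟫_ℝ < t i 0 := by
      rcases hPt x hx i with h | h
      · exact h
      · exact absurd (h j y hyL) (not_le.2 hdist)
    have h1 : ⟪x + r • p, m i⟫_ℝ = ⟪x, m i⟫_ℝ + r * ⟪p, m i⟫_ℝ := by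
      rw [inner_add_left, inner_smul_left]; simp
    show ⟪x + r • p, m i⟫_ℝ < t i 0 + r * s i 0
    rw [h1]
    have h2 : r * ⟪p, m i⟫_ℝ ≤ r * s i 0 := mul_le_mul_of_nonneg_left (hp.2 i) hr.le
    linarith
  have hincL : ∀ i j, L i j + r • TL i j ⊆ U ∩ RL i j := by
    intro i j
    rintro z ⟨x, hx, y, hy, rfl⟩
    obtain ⟨p, hp, rfl⟩ := Set.mem_smul_set.1 hy
    refine ⟨hsubL i j x hx p hp.1, ?_, ?_⟩
    · have h1 : ⟪x + r • p, m i⟫_ℝ = ⟪x, m i⟫_ℝ + r * ⟪p, m i⟫_ℝ := by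
        rw [inner_add_left, inner_smul_left]; simp
      have hx' := hLt i j x hx
      have hp1 : r * s i j.castSucc < r * ⟪p, m i⟫_ℝ := mul_lt_mul_of_pos_left hp.2.1 hr
      have hp2 : r * ⟪p, m i⟫_ℝ ≤ r * s i j.succ := mul_le_mul_of_nonneg_left hp.2.2 hr.le
      show t i j.castSucc + r * s i j.castSucc < ⟪x + r • p, m i⟫_ℝ ∧
        ⟪x + r • p, m i⟫_ℝ < t i j.succ + r * s i j.succ
      rw [h1]
      constructor <;> linarith [hx'.1, hx'.2]
    · rw [Metric.mem_thickening_iff]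
      refine ⟨x, hx, ?_⟩
      have hp5 : ‖p‖ ≤ Real.sqrt 5 := mem_closedBall_zero_iff.1 (hWball (B i j) hp.1)
      rw [dist_eq_norm, add_sub_cancel_left, norm_smul, Real.norm_of_nonneg hr.le, hρ]
      calc r * ‖p‖ ≤ r * Real.sqrt 5 := by gcongr
        _ < r * (Real.sqrt 5 + 1) := by nlinarith
  -- assemble with the piecewise Brunn–Minkowski lemma
  set T : Option (Fin k × Fin n) → Set E3 := fun o => o.elim TP fun p => TL p.1 p.2 with hT
  have hTm : ∀ o, MeasurableSet (T o) := fun o => o.rec hTPm fun p => hTLm p.1 p.2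
  have hreg : ∀ o : Option (Fin k × Fin n),
      G o + r • T o ⊆ U ∩ o.elim RP fun p => RL p.1 p.2 := fun o => by
    cases o with
    | none => exact hincP
    | some p => exact hincL p.1 p.2
  have hdisjR : Pairwise fun o o' : Option (Fin k × Fin n) =>
      Disjoint (U ∩ o.elim RP fun p => RL p.1 p.2) (U ∩ o'.elim RP fun p => RL p.1 p.2) := by
    intro o o' hoo'
    cases o with
    | none =>
      cases o' with
      | none => exact absurd rfl hoo'
      | some p => exact hRPL p.1 p.2
    | some p =>
      cases o' with
      | none => exact (hRPL p.1 p.2).symm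
      | some p' =>
        show Disjoint (U ∩ RL p.1 p.2) (U ∩ RL p'.1 p'.2)
        by_cases hi : p.1 = p'.1
        · have hj : p.2 ≠ p'.2 := fun hj => hoo' (by rw [Prod.ext hi hj])
          have h := hRLL p'.1 p.2 p'.2 hj
          rwa [hi]
        · exact hRLL' p.1 p'.1 hi p.2 p'.2
  have hdisj : Pairwise fun o o' => Disjoint (G o + r • T o) (G o' + r • T o') :=
    fun o o' hoo' => (hdisjR hoo').mono (hreg o) (hreg o')
  have hTvol : ∀ o, ENNReal.ofReal (32 * ((volume (G o)).toReal / (volume (⋃ o, G o)).toReal)) ≤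
      volume (T o) := by
    intro o
    cases o with
    | none => exact hTPvol
    | some p => exact hTLvol p.1 p.2
  have h := piecewise_chimera_lower G T (by norm_num : (0:ℝ) < 32) hGo hTm hdisjG h0' htop' hr hTvol
    hdisj (fun o => (hreg o).trans inter_subset_left)
  rwa [hUG] at h

end Summit.Ventures.Crystal3D.Theorems

end
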